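import Literature.NumberTheory.ComplexMultiplication.EllipticUnits.ImaginaryQuadraticMainConjectureCarriersOExist
import Literature.NumberTheory.EllipticCurves.SharpFlatPAdicLFunctionCoeffField
import HarnessLib

/-!
# Route `SignedLowerHalves`, crux L `SmallImageLowerHalfBothSigns` (stmt-BirchSwinnertonDyer-23599), line `rtt_w3` v14 — E2, junction row (J1): THE CARRIER
# `B = 𝐇^i_P(K_∞/K, 𝒪(θ)(1)) = lim←_{n,k} H^i(G_P(K_n), 𝒪 ⊗ μ_{p^k} ⊗ θ)` OVER ONE `ℤ_p`-TOWER, as a `Λ_𝒪 = 𝒪⟦T⟧`-module (`T ↦ conj_γ − 1`,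
# `c ↦ H^i(c ⊗ id)`) with the scalar-tower `Λ = ℤ_p⟦T⟧`-structure — PINNED DATUM + EXISTENCE

INPUTS hand `bsd-inputs-honda-p1` g23 under LEAD `cruxlead-stmt-BirchSwinnertonDyer-23599` g11 (KEYS 2026-08-30T17:57:50Z «J1 carrier `B = 𝐇¹_Σ(K^cyc_∞, T*)` with
Λ_𝒪-structure + scalar tower from `IwasawaCohomologyDataO … 1`»; BRIEF-E2 rev 4 §3 row J1). The binder `B` (`[Module Λ_𝒪 B] [Module Λ B] [IsScalarTower Λ Λ_𝒪 B]`)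
of the LEAD's `SmallImageRttCharRoad.charRoad_E2_of_roadD_junction` (p780454) is the ONE-VARIABLE TWIN of honda g22's two-variable pinned carriers
`JohnsonLeungKings2011.IwasawaCohomologyDataO` (p776397) / `iwasawaCohomologyDataO` (p777117): SAME level groups `levelCohO S P θ U k i =
H^i_cont(U_P, (𝒪 ⊗ μ_{p^k} ⊗ θ)^{N_P})`, transition maps `relCoresO`/`levelRedO`, coefficient action `levelScalarO`, ONE conjugation variable `levelConjO … γ` along the
layers `U_n = κ.layerSubgroup n = Gal(K̄/K_n)` of ONE `ℤ_p`-extension `κ` (the cyclotomic one in the junction), ANY set of places `P` (junction: `P = supp(p𝔣)`).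
DEFINITIONS WITH BODIES + A CONSTRUCTION + THEOREMS; no named fact, no `sorry`, no instance beyond the structure-field projections (the pattern of
`IwasawaCohomologyDataO`); crux L, crux M, E2 and BSD remain OPEN and are proved for NO curve by any of this.
* §1 `cycLayerCohO`/`cycLayerCoresO`/`cycLayerRedO`/`cycLayerConjO`/`cycLayerScalarO` — the level data along `κ.layerSubgroup n`.
* §2 ★ `CycIwasawaCohomologyDataO S κ γ θ P i` — the PINNED datum: `H`, `[Module (IwasawaAlgebraO S) H]`, `proj n k`, pins (P1) cores, (P2) reductions, (P3) jointly
  injective, (P4) onto the compatible families, (P5) `T ↦ conj_γ − 1`, (P7) constants `C c ↦ H^i(c ⊗ id)`, (P8) continuity; the SCALAR-TOWER `Λ`-structure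
  `moduleIwasawa` (restriction along `iwasawaToIwasawaO S : Λ → Λ_𝒪`), `isScalarTower_moduleIwasawa`, `proj_T_smul`.
* §3 layer operators: `pow_mem_layerSubgroup`, unipotence `cycLayerConjEndO_pow_apply_eq_self` (`i ≤ 2`), the `𝒪`-linear `cycLayerPsiO = conj_γ − 1` and its local
  nilpotence, equivariance / `𝒪`-linearity of cores (tree `relCor_conjMap`, `relCor_cohomologyMap`) and reductions.
* §4 CONSTRUCTION: `cycLayerModuleO` (`LocallyNilpotent.exists_module_powerSeries`), `cycLayerCoresO_smul`/`cycLayerRedO_smul` (`map_smul_of_comp_eq`),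
  `cycCompatibleFamiliesO`, ★★ `cycIwasawaCohomologyDataO`, ★★ `nonempty_cycIwasawaCohomologyDataO` (`i ≤ 2`) — for EVERY number field `K`, prime `p`,
  coefficient set `S`, `ℤ_p`-extension `κ`, element `γ`, character `θ`, set of places `P`.
Not here (J2/J3): the specialisation `sp¹ : H¹₂/f → B` (levelwise `relCoresO` along `pairLayerSubgroup κ κ₂ n ≤ κ.layerSubgroup n` = `inf_le_left`) and the pairing
map `P : B → Hom(E^{ε}_{sat,v}, ℚ/ℤ)` of `exists_junction_linearMap` (p779548).
References: [Kato2004Asterisque] §8.2 (p. 180), §12.2 (12.2.1) (p. 220); [JohnsonLeungKings2011] §4.1 Def. 4.1, §4.2 Def. 4.2 (94) (arXiv 0804.2828 p0012);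
[Lang1990] Ch. 5 §1; [NeukirchSchmidtWingberg2008] I §5 Prop. 1.5.2–1.5.4; [SerreLocalFields1979] VII §5 Prop. 3.
-/

set_option autoImplicit false
-- the Theorems namespace of this sub repeats the summit name by design (D-0017 nested layout)
set_option linter.dupNamespace false

noncomputable section

open scoped NumberField PowerSeries
open CategoryTheory Field IsDedekindDomain
open Literature.NumberTheory.GaloisRepresentations
open Literature.NumberTheory.GaloisRepresentations.DiscreteGaloisModule
open Literature.NumberTheory.EllipticCurves Literature.NumberTheory.EllipticCurves.IwasawaDual
open Literature.NumberTheory.ComplexMultiplication.EllipticUnits.JohnsonLeungKings2011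
open Literature.Algebra.Module.LocallyNilpotent

namespace Summit.BirchSwinnertonDyer.BirchSwinnertonDyer.Theorems.SmallImageRttD2J1

universe u

section Layers

variable {K : Type} [Field K] [NumberField K] {p : ℕ} [Fact p.Prime] (S : Set (PadicAlgCl p))
  (κ : ZpExtension K p) (θ : absoluteGaloisGroup K →ₜ* (padicCoeffIntegers S)ˣ) (P : Set (HeightOneSpectrum (𝓞 K)))

/-- **The layer groups `H^i(G_P(K_n), 𝒪 ⊗ μ_{p^k} ⊗ θ)`** of the `ℤ_p`-tower `K_n = K̄^{κ.layerSubgroup n}` (g22's `levelCohO` at `U = Gal(K̄/K_n)`): the level-`(n, k)`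
term of `𝐇^i_P(K_∞/K, 𝒪(θ)(1)) = lim←_{n,k}`. [cite: Kato2004Asterisque, §8.2 (p. 180) and §12.2 (12.2.1) (p. 220)] [cite: JohnsonLeungKings2011, Def. 4.2 (94) (arXiv p0012:L94)] -/
abbrev cycLayerCohO (n k i : ℕ) : Type :=
  levelCohO S P θ (κ.layerSubgroup n) k i

/-- The transition map in `n`: `cor_{K_{n+1}/K_n}` (g22's `relCoresO` along `κ.layerSubgroup (n+1) ≤ κ.layerSubgroup n`). [cite: SerreGaloisCohomology1997, I §2.5] -/
def cycLayerCoresO (n k i : ℕ) : cycLayerCohO S κ θ P (n + 1) k i →+ cycLayerCohO S κ θ P n k i :=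
  relCoresO S P θ (κ.layerSubgroup_antitone (Nat.le_succ n)) (κ.isOpen_layerSubgroup n) (κ.isOpen_layerSubgroup (n + 1)) k i

/-- The transition map in `k`: reduction `𝒪 ⊗ μ_{p^{k+1}} ⊗ θ → 𝒪 ⊗ μ_{p^k} ⊗ θ`. [cite: Kato2004Asterisque, §8.2 (p. 180)] -/
def cycLayerRedO (n k i : ℕ) : cycLayerCohO S κ θ P n (k + 1) i →+ cycLayerCohO S κ θ P n k i :=
  levelRedO S P θ (κ.layerSubgroup n) k i

/-- The conjugation action of `γ ∈ Γ_K` on the layer groups. [cite: JohnsonLeungKings2011, §4.2 (arXiv p0012:L109–112)] -/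
def cycLayerConjO (n k i : ℕ) (γ : absoluteGaloisGroup K) : cycLayerCohO S κ θ P n k i →+ cycLayerCohO S κ θ P n k i :=
  levelConjO S P θ (κ.layerSubgroup n) k i γ

/-- The coefficient multiplication `H^i(c ⊗ id)` by `c ∈ 𝒪` on the layer groups. [cite: JohnsonLeungKings2011, §4.1 Def. 4.1 (arXiv p0012:L59–60)] -/
def cycLayerScalarO (n k i : ℕ) (c : padicCoeffIntegers S) : cycLayerCohO S κ θ P n k i →+ cycLayerCohO S κ θ P n k i :=
  levelScalarO S P θ (κ.layerSubgroup n) k i c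

end Layers

section Data

variable {K : Type} [Field K] [NumberField K] {p : ℕ} [Fact p.Prime] (S : Set (PadicAlgCl p))
  (κ : ZpExtension K p) (γ : absoluteGaloisGroup K) (θ : absoluteGaloisGroup K →ₜ* (padicCoeffIntegers S)ˣ)
  (P : Set (HeightOneSpectrum (𝓞 K)))

/-- ★ **PINNED `Λ_𝒪 = 𝒪⟦T⟧`-MODULE DATA FOR `𝐇^i_P(K_∞/K, 𝒪(θ)(1)) = lim←_{n,k} H^i(G_P(K_n), 𝒪 ⊗ μ_{p^k} ⊗ θ)`** over ONE `ℤ_p`-extension `κ` of `K`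
(`K_n = K̄^{κ.layerSubgroup n}`) — the one-variable twin of `JohnsonLeungKings2011.IwasawaCohomologyDataO`. Data: an abstract `Λ_𝒪 = IwasawaAlgebraO S = 𝒪⟦T⟧`-module
`H` with additive projections `proj n k : H → H^i(G_P(K_n), 𝒪 ⊗ μ_{p^k} ⊗ θ)`. Pins: (P1)–(P2) compatibility with the corestrictions in `n` and the reductions
in `k`; (P3) joint injectivity and (P4) joint surjectivity onto the compatible families; (P5) `T = PowerSeries.X` acts as `conj_γ − 1` (the
`Λ = ℤ_p⟦Gal(K_∞/K)⟧`-structure, `γ` a topological generator in the intended use); (P7) constants `c ∈ 𝒪` act on the level `(n, k)` by `H^i(c ⊗ id)`;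
(P8) (continuity) each `ker (proj n k)` is a `Λ_𝒪`-submodule. Nothing is asserted; existence = §4. Use: `B` of row (J1) (`κ` cyclotomic, `P = supp(p𝔣)`, `i = 1`).
[cite: Kato2004Asterisque, §8.2 (p. 180), §12.2 (12.2.1) (p. 220)] [cite: JohnsonLeungKings2011, §4.1 Def. 4.1 and §4.2 Def. 4.2 (94) (arXiv p0012:L39–60, L80–112)] -/
structure CycIwasawaCohomologyDataO (i : ℕ) : Type 1 where
  /-- The underlying type of `𝐇^i_P(K_∞/K, 𝒪(θ)(1))`. -/
  H : Type
  /-- `𝐇^i` is an abelian group. -/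
  [addCommGroup : AddCommGroup H]
  /-- `𝐇^i` is a `Λ_𝒪 = 𝒪⟦T⟧`-module. -/
  [module : Module (IwasawaAlgebraO S) H]
  /-- The projection to the level `(n, k)`: `𝐇^i → H^i(G_P(K_n), 𝒪 ⊗ μ_{p^k} ⊗ θ)`. -/
  proj : ∀ n k : ℕ, H →+ cycLayerCohO S κ θ P n k i
  /-- (P1) compatibility with the corestrictions `cor_{K_{n+1}/K_n}`. -/
  proj_cores : ∀ (n k : ℕ) (x : H), cycLayerCoresO S κ θ P n k i (proj (n + 1) k x) = proj n k x
  /-- (P2) compatibility with the reductions `𝒪 ⊗ μ_{p^{k+1}} → 𝒪 ⊗ μ_{p^k}`. -/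
  proj_red : ∀ (n k : ℕ) (x : H), cycLayerRedO S κ θ P n k i (proj n (k + 1) x) = proj n k x
  /-- (P3) the projections are jointly injective. -/
  proj_injective : ∀ x : H, (∀ n k, proj n k x = 0) → x = 0
  /-- (P4) every compatible family (`cor y_{n+1,k} = y_{n,k}`, `red y_{n,k+1} = y_{n,k}`) comes from `H`. -/
  proj_surjective : ∀ y : (∀ n k : ℕ, cycLayerCohO S κ θ P n k i),
    (∀ n k, cycLayerCoresO S κ θ P n k i (y (n + 1) k) = y n k) → (∀ n k, cycLayerRedO S κ θ P n k i (y n (k + 1)) = y n k) →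
      ∃ x : H, ∀ n k, proj n k x = y n k
  /-- (P5) `T` acts as `conj_γ − 1`. -/
  proj_X_smul : ∀ (n k : ℕ) (x : H),
    proj n k ((PowerSeries.X : IwasawaAlgebraO S) • x) = cycLayerConjO S κ θ P n k i γ (proj n k x) - proj n k x
  /-- (P7) constants `c ∈ 𝒪` act on the level `(n, k)` by the coefficient multiplication `H^i(c ⊗ id)`. -/
  proj_C_smul : ∀ (c : padicCoeffIntegers S) (n k : ℕ) (x : H),
    proj n k ((PowerSeries.C c : IwasawaAlgebraO S) • x) = cycLayerScalarO S κ θ P n k i c (proj n k x)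
  /-- (P8) (continuity) each `ker (proj n k)` is a `Λ_𝒪`-submodule. -/
  proj_smul_eq_zero : ∀ (n k : ℕ) (f : IwasawaAlgebraO S) (x : H), proj n k x = 0 → proj n k (f • x) = 0

attribute [instance] CycIwasawaCohomologyDataO.addCommGroup CycIwasawaCohomologyDataO.module

namespace CycIwasawaCohomologyDataO

variable {S κ γ θ P} {i : ℕ} (I : CycIwasawaCohomologyDataO S κ γ θ P i)

/-- **The scalar-tower `Λ = ℤ_p⟦T⟧`-structure** on `𝐇^i`: restriction of scalars along `iwasawaToIwasawaO S : Λ → Λ_𝒪` (coefficientwise `ℤ_p → 𝒪`). A `def`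
(activate with `letI`), as the consumer's binder `[Module Λ B]`. [cite: JohnsonLeungKings2011, §4.1 Def. 4.1 (Λ_𝒪 = Λ ⊗̂ 𝒪_p, arXiv p0012:L59–60)] -/
@[reducible] def moduleIwasawa : Module (IwasawaAlgebra p) I.H :=
  Module.compHom I.H (iwasawaToIwasawaO S)

/-- The `Λ`-action is `g • x = (iwasawaToIwasawaO S g) • x` (unfolding). [cite: JohnsonLeungKings2011, §4.1 Def. 4.1 (arXiv p0012:L59–60)] -/
theorem moduleIwasawa_smul (g : IwasawaAlgebra p) (x : I.H) :
    (letI := I.moduleIwasawa; g • x) = iwasawaToIwasawaO S g • x := rfl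

/-- **`IsScalarTower Λ Λ_𝒪 𝐇^i`** for the algebra structure `Λ → Λ_𝒪` given by `iwasawaToIwasawaO S` (the consumer's `letI := (iwasawaToIwasawaO S).toAlgebra`).
[cite: JohnsonLeungKings2011, §4.1 Def. 4.1 (arXiv p0012:L59–60)] -/
theorem isScalarTower_moduleIwasawa :
    letI := I.moduleIwasawa
    letI := (iwasawaToIwasawaO S).toAlgebra
    IsScalarTower (IwasawaAlgebra p) (IwasawaAlgebraO S) I.H := by
  letI := I.moduleIwasawa
  letI := (iwasawaToIwasawaO S).toAlgebra
  exact ⟨fun g f x ↦ by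
    change (g • f) • x = iwasawaToIwasawaO S g • (f • x)
    rw [Algebra.smul_def, mul_smul]
    rfl⟩

/-- (P5) for the `Λ`-structure: Λ's variable also acts as `conj_γ − 1` (`iwasawaToIwasawaO S X = X`). [cite: JohnsonLeungKings2011, §4.2 (arXiv p0012:L109–112)] -/
theorem proj_T_smul (n k : ℕ) (x : I.H) :
    I.proj n k (letI := I.moduleIwasawa; (PowerSeries.X : IwasawaAlgebra p) • x) =
      cycLayerConjO S κ θ P n k i γ (I.proj n k x) - I.proj n k x := by
  rw [moduleIwasawa_smul, show iwasawaToIwasawaO S (PowerSeries.X : IwasawaAlgebra p) = PowerSeries.X from PowerSeries.map_X _,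
    I.proj_X_smul]

end CycIwasawaCohomologyDataO

end Data

section LayerOps

variable {K : Type} [Field K] [NumberField K] {p : ℕ} [Fact p.Prime] (S : Set (PadicAlgCl p))
  (κ : ZpExtension K p) (γ : absoluteGaloisGroup K) (θ : absoluteGaloisGroup K →ₜ* (padicCoeffIntegers S)ˣ)
  (P : Set (HeightOneSpectrum (𝓞 K)))

omit [NumberField K] in
/-- **`γ^{pⁿ} ∈ Gal(K̄/K_n)` for every `γ ∈ Γ_K`** (`κ(γ^{pⁿ}) = pⁿ·κ(γ) ∈ pⁿℤ_p`). [cite: Lang1990, Ch. 5 §1] -/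
theorem pow_mem_layerSubgroup (n : ℕ) : γ ^ p ^ n ∈ κ.layerSubgroup n := by
  rw [ZpExtension.mem_layerSubgroup, map_pow, toAdd_pow, nsmul_eq_mul, Nat.cast_pow]
  exact Dvd.intro _ rfl

/-- The conjugation operator of `γ` on the layer group `(n, k)`, in `AddMonoid.End`. [cite: JohnsonLeungKings2011, §4.2 (arXiv p0012:L109–112)] -/
abbrev cycLayerConjEndO (n k i : ℕ) (γ : absoluteGaloisGroup K) : AddMonoid.End (cycLayerCohO S κ θ P n k i) :=
  conjEndO S P θ (κ.layerSubgroup n) k i γ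

/-- **`(γ ·)^{pⁿ} = id` on the layer `(n, k)`**, `i ≤ 2` (`γ^{pⁿ} ∈ Gal(K̄/K_n)` acts as an inner automorphism). [cite: SerreLocalFields1979, VII §5 Prop. 3] -/
theorem cycLayerConjEndO_pow_apply_eq_self (n k : ℕ) {i : ℕ} (hi : i ≤ 2) (c : cycLayerCohO S κ θ P n k i) :
    (cycLayerConjEndO S κ θ P n k i γ ^ p ^ n) c = c := by
  rw [cycLayerConjEndO, conjEndO_pow_apply]
  exact levelConjO_eq_self_of_mem S P θ (pow_mem_layerSubgroup κ γ n) (κ.isOpen_layerSubgroup n) k hi c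

/-- **`conj_γ − 1` is locally nilpotent on every layer group**, `i ≤ 2` (uniform `p^k`-torsion + unipotence of echelon `pⁿ`; the tree's
`exists_pow_twistEnd_sub_one_apply_eq_zero` at the trivial twist). [cite: Lang1990, Ch. 5 §1] -/
theorem exists_pow_cycLayerConjEndO_sub_one_apply_eq_zero (n k : ℕ) {i : ℕ} (hi : i ≤ 2) (c : cycLayerCohO S κ θ P n k i) :
    ∃ M : ℕ, ((cycLayerConjEndO S κ θ P n k i γ - 1) ^ M) c = 0 := by
  have h := exists_pow_twistEnd_sub_one_apply_eq_zero (p := p) (n := 1) (e := k) (m := n) (cycLayerConjEndO S κ θ P n k i γ)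
    (fun a ↦ cycLayerConjEndO_pow_apply_eq_self S κ γ θ P n k hi a)
    (fun a ↦ levelCohO_torsion S P θ (κ.isOpen_layerSubgroup n) k i a)
    (by rw [Nat.cast_one, sub_self]; exact dvd_zero _) c
  rwa [twistEnd_one] at h

/-- **The `𝒪`-LINEAR operator `ψ_γ = conj_γ − 1` on the layer `(n, k)`** (`conj_γ` commutes with every `H^i(c ⊗ id)`). [cite: JohnsonLeungKings2011, §4.2 (arXiv p0012:L109–112)] -/
def cycLayerPsiO (n k i : ℕ) (γ : absoluteGaloisGroup K) :
    letI := levelModuleO S P θ (κ.layerSubgroup n) k i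
    Module.End (padicCoeffIntegers S) (cycLayerCohO S κ θ P n k i) := by
  letI := levelModuleO S P θ (κ.layerSubgroup n) k i
  exact
    { toFun := fun c ↦ cycLayerConjO S κ θ P n k i γ c - c
      map_add' := fun x y ↦ by rw [map_add]; abel
      map_smul' := fun c x ↦ by
        change levelConjO S P θ _ k i γ (levelScalarO S P θ _ k i c x) - levelScalarO S P θ _ k i c x =
          levelScalarO S P θ _ k i c (levelConjO S P θ _ k i γ x - x)
        rw [map_sub, levelScalarO_levelConjO] }

omit [NumberField K] in
/-- Unfolding `cycLayerPsiO`: `ψ_γ c = γ·c − c`. [cite: JohnsonLeungKings2011, §4.2 (arXiv p0012:L109–112)] -/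
theorem cycLayerPsiO_apply (n k i : ℕ) (γ : absoluteGaloisGroup K) (c : cycLayerCohO S κ θ P n k i) :
    (letI := levelModuleO S P θ (κ.layerSubgroup n) k i
     cycLayerPsiO S κ θ P n k i γ c) = cycLayerConjO S κ θ P n k i γ c - c := rfl

omit [NumberField K] in
/-- Powers of `ψ_γ` agree with powers of `conj_γ − 1` in `AddMonoid.End`. [folklore] -/
theorem cycLayerPsiO_pow_apply (n k i : ℕ) (γ : absoluteGaloisGroup K) (m : ℕ) (c : cycLayerCohO S κ θ P n k i) :
    (letI := levelModuleO S P θ (κ.layerSubgroup n) k i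
     (cycLayerPsiO S κ θ P n k i γ ^ m) c) = ((cycLayerConjEndO S κ θ P n k i γ - 1) ^ m) c := by
  letI := levelModuleO S P θ (κ.layerSubgroup n) k i
  induction m generalizing c with
  | zero => rfl
  | succ m ih =>
    rw [pow_succ, pow_succ, Module.End.mul_apply, AddMonoid.End.coe_mul, Function.comp_apply, cycLayerPsiO_apply, ih]
    rfl

/-- **`ψ_γ` is locally nilpotent on every layer group**, `i ≤ 2` — the hypothesis of `LocallyNilpotent.exists_module_powerSeries`. [cite: Lang1990, Ch. 5 §1] -/
theorem cycLayerPsiO_locallyNilpotent (n k : ℕ) {i : ℕ} (hi : i ≤ 2) (c : cycLayerCohO S κ θ P n k i) :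
    letI := levelModuleO S P θ (κ.layerSubgroup n) k i
    ∃ m : ℕ, (cycLayerPsiO S κ θ P n k i γ ^ m) c = 0 := by
  obtain ⟨m, hm⟩ := exists_pow_cycLayerConjEndO_sub_one_apply_eq_zero S κ γ θ P n k hi c
  exact ⟨m, by rw [cycLayerPsiO_pow_apply, hm]⟩

/-- **The corestrictions intertwine the conjugation operators and are `𝒪`-linear** (the tree's `relCor_conjMap`, `relCor_cohomologyMap` on the finite-index
closed pair `imGS P (κ.layerSubgroup (n+1)) ≤ imGS P (κ.layerSubgroup n)`). [cite: NeukirchSchmidtWingberg2008, I §5 Prop. 1.5.2–1.5.4] -/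
theorem cycLayerCoresO_comm (n k i : ℕ) :
    (∀ (γ : absoluteGaloisGroup K) (y : cycLayerCohO S κ θ P (n + 1) k i),
        cycLayerCoresO S κ θ P n k i (cycLayerConjO S κ θ P (n + 1) k i γ y) = cycLayerConjO S κ θ P n k i γ (cycLayerCoresO S κ θ P n k i y)) ∧
      ∀ (c : padicCoeffIntegers S) (y : cycLayerCohO S κ θ P (n + 1) k i),
        cycLayerCoresO S κ θ P n k i (cycLayerScalarO S κ θ P (n + 1) k i c y) = cycLayerScalarO S κ θ P n k i c (cycLayerCoresO S κ θ P n k i y) := by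
  haveI : TotallyDisconnectedSpace (GaloisGroupUnramifiedOutside K P) :=
    Literature.GroupTheory.ProfiniteSubquotients.totallyDisconnectedSpace_quotient (ramificationSubgroup K P) (ramificationSubgroup_isClosed K _)
  haveI := normal_imGS P (κ.layerSubgroup n)
  haveI := normal_imGS P (κ.layerSubgroup (n + 1))
  haveI : IsClosed (imGS P (κ.layerSubgroup n) : Set (GaloisGroupUnramifiedOutside K P)) := isClosed_imGS' _ (κ.isOpen_layerSubgroup n)
  haveI : IsClosed (imGS P (κ.layerSubgroup (n + 1)) : Set (GaloisGroupUnramifiedOutside K P)) := isClosed_imGS' _ (κ.isOpen_layerSubgroup (n + 1))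
  haveI : ((imGS P (κ.layerSubgroup (n + 1))).subgroupOf (imGS P (κ.layerSubgroup n))).FiniteIndex := by
    haveI := finiteIndex_imGS' P (κ.isOpen_layerSubgroup (n + 1))
    infer_instance
  letI : Fintype (↥(imGS P (κ.layerSubgroup n)) ⧸ (imGS P (κ.layerSubgroup (n + 1))).subgroupOf (imGS P (κ.layerSubgroup n))) := Fintype.ofFinite _
  exact ⟨fun γ y ↦ relCor_conjMap (imGS P (κ.layerSubgroup n)) (imGS P (κ.layerSubgroup (n + 1))) (coeffGSO S P θ k) (toUnramifiedQuot K P γ)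
      (Subgroup.map_mono (κ.layerSubgroup_antitone (Nat.le_succ n))) i y,
    fun c y ↦ relCor_cohomologyMap (imGS P (κ.layerSubgroup n)) (imGS P (κ.layerSubgroup (n + 1))) (coeffGSO S P θ k) (coeffGSO S P θ k)
      (coeffMapHomO S P θ (oMuScalar S (p ^ k) c) (oMuScalar_muTwistO S θ k c)) (Subgroup.map_mono (κ.layerSubgroup_antitone (Nat.le_succ n))) i y⟩

omit [NumberField K] in
/-- **The reductions intertwine the conjugation operators on the layers.** [cite: Kato2004Asterisque, §8.2 (p. 180)] -/
theorem cycLayerRedO_cycLayerConjO (n k i : ℕ) (γ : absoluteGaloisGroup K) (y : cycLayerCohO S κ θ P n (k + 1) i) :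
    cycLayerRedO S κ θ P n k i (cycLayerConjO S κ θ P n (k + 1) i γ y) = cycLayerConjO S κ θ P n k i γ (cycLayerRedO S κ θ P n k i y) :=
  levelRedO_levelConjO S P θ (κ.layerSubgroup n) k i γ y

omit [NumberField K] in
/-- **The reductions are `𝒪`-linear on the layers.** [cite: Kato2004Asterisque, §8.2 (p. 180)] -/
theorem cycLayerRedO_cycLayerScalarO (n k i : ℕ) (c : padicCoeffIntegers S) (y : cycLayerCohO S κ θ P n (k + 1) i) :
    cycLayerRedO S κ θ P n k i (cycLayerScalarO S κ θ P n (k + 1) i c y) = cycLayerScalarO S κ θ P n k i c (cycLayerRedO S κ θ P n k i y) :=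
  levelRedO_levelScalarO S P θ (κ.layerSubgroup n) k i c y

end LayerOps

section Construction

variable {K : Type} [Field K] [NumberField K] {p : ℕ} [Fact p.Prime] (S : Set (PadicAlgCl p))
  (κ : ZpExtension K p) (γ : absoluteGaloisGroup K) (θ : absoluteGaloisGroup K →ₜ* (padicCoeffIntegers S)ˣ)
  (P : Set (HeightOneSpectrum (𝓞 K))) {i : ℕ} (hi : i ≤ 2)

include γ hi

/-- **Existence of the `Λ_𝒪 = 𝒪⟦T⟧`-structure on the layer group** (`i ≤ 2`): `X ↦ ψ_γ`, constants `C a ↦ H^i(a ⊗ id)` — `LocallyNilpotent.exists_module_powerSeries`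
on the locally nilpotent `𝒪`-linear `ψ_γ`. [cite: JohnsonLeungKings2011, §4.2 (arXiv p0012:L109–112)] [cite: Lang1990, Ch. 5 §1] -/
theorem exists_cycLayerModuleO (n k : ℕ) :
    letI := levelModuleO S P θ (κ.layerSubgroup n) k i
    ∃ (_ : Module (IwasawaAlgebraO S) (cycLayerCohO S κ θ P n k i)),
      (∀ (a : padicCoeffIntegers S) (v : cycLayerCohO S κ θ P n k i), (PowerSeries.C a : IwasawaAlgebraO S) • v = a • v) ∧
        ∀ v : cycLayerCohO S κ θ P n k i, (PowerSeries.X : IwasawaAlgebraO S) • v = cycLayerPsiO S κ θ P n k i γ v := by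
  letI := levelModuleO S P θ (κ.layerSubgroup n) k i
  exact exists_module_powerSeries (cycLayerPsiO S κ θ P n k i γ) (cycLayerPsiO_locallyNilpotent S κ γ θ P n k hi)

/-- **The `Λ_𝒪 = 𝒪⟦T⟧`-structure of the layer group** (`i ≤ 2`; a choice from `exists_cycLayerModuleO`, whose ACTION is forced; activate with `letI`). [cite: Lang1990, Ch. 5 §1] -/
@[reducible] def cycLayerModuleO (n k : ℕ) : Module (IwasawaAlgebraO S) (cycLayerCohO S κ θ P n k i) :=
  (exists_cycLayerModuleO S κ γ θ P hi n k).choose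

/-- The defining identities of the chosen structure: `C a ↦ H^i(a ⊗ id)`, `T ↦ ψ_γ`. [cite: JohnsonLeungKings2011, §4.2 (arXiv p0012:L109–112)] -/
theorem cycLayerModuleO_spec (n k : ℕ) :
    letI := levelModuleO S P θ (κ.layerSubgroup n) k i
    letI := cycLayerModuleO S κ γ θ P hi n k
    (∀ (a : padicCoeffIntegers S) (v : cycLayerCohO S κ θ P n k i), (PowerSeries.C a : IwasawaAlgebraO S) • v = a • v) ∧
      ∀ v : cycLayerCohO S κ θ P n k i, (PowerSeries.X : IwasawaAlgebraO S) • v = cycLayerPsiO S κ θ P n k i γ v :=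
  (exists_cycLayerModuleO S κ γ θ P hi n k).choose_spec

/-- **The corestrictions are `Λ_𝒪`-linear** (`map_smul_of_comp_eq`: `𝒪`-linear and intertwine `ψ_γ`). [cite: NeukirchSchmidtWingberg2008, I §5 Prop. 1.5.2–1.5.4] -/
theorem cycLayerCoresO_smul (n k : ℕ) (F : IwasawaAlgebraO S) (y : cycLayerCohO S κ θ P (n + 1) k i) :
    cycLayerCoresO S κ θ P n k i (letI := cycLayerModuleO S κ γ θ P hi (n + 1) k; F • y) =
      (letI := cycLayerModuleO S κ γ θ P hi n k; F • cycLayerCoresO S κ θ P n k i y) := by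
  letI i0 := levelModuleO S P θ (κ.layerSubgroup (n + 1)) k i
  letI i2 := cycLayerModuleO S κ γ θ P hi (n + 1) k
  letI j0 := levelModuleO S P θ (κ.layerSubgroup n) k i
  letI j2 := cycLayerModuleO S κ γ θ P hi n k
  obtain ⟨hC, hX⟩ := cycLayerModuleO_spec S κ γ θ P hi (n + 1) k
  obtain ⟨hC', hX'⟩ := cycLayerModuleO_spec S κ γ θ P hi n k
  let f : cycLayerCohO S κ θ P (n + 1) k i →ₗ[padicCoeffIntegers S] cycLayerCohO S κ θ P n k i :=
    { toFun := cycLayerCoresO S κ θ P n k i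
      map_add' := map_add _
      map_smul' := fun c y ↦ (cycLayerCoresO_comm S κ θ P n k i).2 c y }
  exact map_smul_of_comp_eq hC hX hC' hX' (cycLayerPsiO_locallyNilpotent S κ γ θ P (n + 1) k hi) f
    (fun y ↦ by
      change cycLayerCoresO S κ θ P n k i (cycLayerConjO S κ θ P (n + 1) k i γ y - y) =
        cycLayerConjO S κ θ P n k i γ (cycLayerCoresO S κ θ P n k i y) - cycLayerCoresO S κ θ P n k i y
      rw [map_sub, (cycLayerCoresO_comm S κ θ P n k i).1]) F y

/-- **The reductions are `Λ_𝒪`-linear.** [cite: Kato2004Asterisque, §8.2 (p. 180)] [cite: Lang1990, Ch. 5 §1] -/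
theorem cycLayerRedO_smul (n k : ℕ) (F : IwasawaAlgebraO S) (y : cycLayerCohO S κ θ P n (k + 1) i) :
    cycLayerRedO S κ θ P n k i (letI := cycLayerModuleO S κ γ θ P hi n (k + 1); F • y) =
      (letI := cycLayerModuleO S κ γ θ P hi n k; F • cycLayerRedO S κ θ P n k i y) := by
  letI i0 := levelModuleO S P θ (κ.layerSubgroup n) (k + 1) i
  letI i2 := cycLayerModuleO S κ γ θ P hi n (k + 1)
  letI j0 := levelModuleO S P θ (κ.layerSubgroup n) k i
  letI j2 := cycLayerModuleO S κ γ θ P hi n k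
  obtain ⟨hC, hX⟩ := cycLayerModuleO_spec S κ γ θ P hi n (k + 1)
  obtain ⟨hC', hX'⟩ := cycLayerModuleO_spec S κ γ θ P hi n k
  let f : cycLayerCohO S κ θ P n (k + 1) i →ₗ[padicCoeffIntegers S] cycLayerCohO S κ θ P n k i :=
    { toFun := cycLayerRedO S κ θ P n k i
      map_add' := map_add _
      map_smul' := fun c y ↦ cycLayerRedO_cycLayerScalarO S κ θ P n k i c y }
  exact map_smul_of_comp_eq hC hX hC' hX' (cycLayerPsiO_locallyNilpotent S κ γ θ P n (k + 1) hi) f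
    (fun y ↦ by
      change cycLayerRedO S κ θ P n k i (cycLayerConjO S κ θ P n (k + 1) i γ y - y) =
        cycLayerConjO S κ θ P n k i γ (cycLayerRedO S κ θ P n k i y) - cycLayerRedO S κ θ P n k i y
      rw [map_sub, cycLayerRedO_cycLayerConjO]) F y

/-- The product `Λ_𝒪`-module `∏_{n,k} H^i(G_P(K_n), 𝒪 ⊗ μ_{p^k} ⊗ θ)` (activate with `letI`). [cite: Kato2004Asterisque, §8.2 (p. 180)] -/
@[reducible] def piCycLayerModuleO : Module (IwasawaAlgebraO S) (∀ n k : ℕ, cycLayerCohO S κ θ P n k i) := by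
  letI : ∀ n k : ℕ, Module (IwasawaAlgebraO S) (cycLayerCohO S κ θ P n k i) := fun n k ↦ cycLayerModuleO S κ γ θ P hi n k
  infer_instance

/-- The product action is componentwise. [cite: Kato2004Asterisque, §8.2 (p. 180)] -/
theorem piCycLayerModuleO_smul_apply (F : IwasawaAlgebraO S) (y : ∀ n k : ℕ, cycLayerCohO S κ θ P n k i) (n k : ℕ) :
    (letI := piCycLayerModuleO S κ γ θ P hi; F • y) n k = (letI := cycLayerModuleO S κ γ θ P hi n k; F • y n k) := rfl

/-- **`𝐇^i_P(K_∞/K, 𝒪(θ)(1)) := lim←_{n,k} H^i(G_P(K_n), 𝒪 ⊗ μ_{p^k} ⊗ θ)` as a `Λ_𝒪`-SUBMODULE of the product**: the compatible families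
stable under `Λ_𝒪` because the corestrictions and the reductions are `Λ_𝒪`-linear. [cite: Kato2004Asterisque, §8.2 (p. 180) and §12.2 (12.2.1) (p. 220)] -/
def cycCompatibleFamiliesO :
    letI := piCycLayerModuleO S κ γ θ P hi
    Submodule (IwasawaAlgebraO S) (∀ n k : ℕ, cycLayerCohO S κ θ P n k i) := by
  letI := piCycLayerModuleO S κ γ θ P hi
  exact
    { carrier := {y | (∀ n k, cycLayerCoresO S κ θ P n k i (y (n + 1) k) = y n k) ∧ ∀ n k, cycLayerRedO S κ θ P n k i (y n (k + 1)) = y n k}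
      zero_mem' := ⟨fun n k ↦ by simp only [Pi.zero_apply, map_zero], fun n k ↦ by simp only [Pi.zero_apply, map_zero]⟩
      add_mem' := fun {y y'} hy hy' ↦
        ⟨fun n k ↦ by simp only [Pi.add_apply, map_add, hy.1 n k, hy'.1 n k], fun n k ↦ by simp only [Pi.add_apply, map_add, hy.2 n k, hy'.2 n k]⟩
      smul_mem' := fun F y hy ↦
        ⟨fun n k ↦ by rw [piCycLayerModuleO_smul_apply, piCycLayerModuleO_smul_apply, cycLayerCoresO_smul, hy.1 n k],
          fun n k ↦ by rw [piCycLayerModuleO_smul_apply, piCycLayerModuleO_smul_apply, cycLayerRedO_smul, hy.2 n k]⟩ }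

/-- ★★ **The pinned datum `𝐇^i_P(K_∞/K, 𝒪(θ)(1))`, CONSTRUCTED** (`i ≤ 2`): carrier = the `Λ_𝒪`-submodule of compatible families, `proj n k` = the coordinates;
(P1)–(P4) by construction, (P5)/(P7) = the defining identities of the `Λ_𝒪`-structure (`T ↦ conj_γ − 1`, `C c ↦ H^i(c ⊗ id)`), (P8) because the action is levelwise.
[cite: Kato2004Asterisque, §8.2 (p. 180), §12.2 (12.2.1) (p. 220)] [cite: JohnsonLeungKings2011, §4.1 Def. 4.1 and §4.2 Def. 4.2 (94) (arXiv p0012:L39–60, L80–112)] -/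
def cycIwasawaCohomologyDataO : CycIwasawaCohomologyDataO S κ γ θ P i :=
  letI := piCycLayerModuleO S κ γ θ P hi
  { H := ↥(cycCompatibleFamiliesO S κ γ θ P hi)
    proj := fun n k ↦
      { toFun := fun y ↦ (y : ∀ n k : ℕ, cycLayerCohO S κ θ P n k i) n k
        map_zero' := rfl
        map_add' := fun _ _ ↦ rfl }
    proj_cores := fun n k y ↦ y.2.1 n k
    proj_red := fun n k y ↦ y.2.2 n k
    proj_injective := fun y hy ↦ Subtype.ext (funext fun n ↦ funext fun k ↦ hy n k)
    proj_surjective := fun y hy hy' ↦ ⟨⟨y, hy, hy'⟩, fun _ _ ↦ rfl⟩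
    proj_X_smul := fun n k y ↦ by
      change (letI := cycLayerModuleO S κ γ θ P hi n k; (PowerSeries.X : IwasawaAlgebraO S) • (y : ∀ n k : ℕ, cycLayerCohO S κ θ P n k i) n k) = _
      rw [(cycLayerModuleO_spec S κ γ θ P hi n k).2, cycLayerPsiO_apply]
      rfl
    proj_C_smul := fun c n k y ↦ by
      change (letI := cycLayerModuleO S κ γ θ P hi n k; (PowerSeries.C c : IwasawaAlgebraO S) • (y : ∀ n k : ℕ, cycLayerCohO S κ θ P n k i) n k) = _
      letI := levelModuleO S P θ (κ.layerSubgroup n) k i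
      rw [(cycLayerModuleO_spec S κ γ θ P hi n k).1]
      rfl
    proj_smul_eq_zero := fun n k F y hy ↦ by
      letI := cycLayerModuleO S κ γ θ P hi n k
      change F • (y : ∀ n k : ℕ, cycLayerCohO S κ θ P n k i) n k = 0
      have hy' : (y : ∀ n k : ℕ, cycLayerCohO S κ θ P n k i) n k = 0 := hy
      rw [hy', smul_zero] }

/-- ★★ **EXISTENCE: `Nonempty (CycIwasawaCohomologyDataO S κ γ θ P i)` for `i ≤ 2`** — for EVERY number field `K`, prime `p`, coefficient set `S ⊆ ℚ̄_p`,
`ℤ_p`-extension `κ`, group element `γ`, character `θ : Γ_K → 𝒪ˣ` and set of places `P`: the junction carrier `B` of row (J1) exists as a genuine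
`Λ_𝒪`-module (the Iwasawa cohomology of the `ℤ_p`-tower with its conjugation-and-coefficient structure). [cite: Kato2004Asterisque, §8.2 (p. 180), §12.2 (12.2.1) (p. 220)] -/
theorem nonempty_cycIwasawaCohomologyDataO : Nonempty (CycIwasawaCohomologyDataO S κ γ θ P i) :=
  ⟨cycIwasawaCohomologyDataO S κ γ θ P hi⟩

end Construction

end Summit.BirchSwinnertonDyer.BirchSwinnertonDyer.Theorems.SmallImageRttD2J1

end
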